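import Mathlib
import Summits.Ventures.PercRepro.PuncturedLYMMixT3Q1Table1
import Summits.Ventures.PercRepro.PuncturedLYMMixT3Q1Table2

/-!
# PercRepro — (SP) FOR `3` PAIRWISE DISJOINT TRIPLES AND `1` PAIRWISE DISJOINT QUADRUPLES AT LEVEL `4`: POSITIVITY OF THE DENOMINATORS (1)
(p10, gen 41)

`den > 0`, `Pc > 0` for `n ≥ 13`; `Yc > 0` for `n ≥ 5`.  Nothing here asserts (SP).
-/

namespace PercRepro.PuncturedLYM.Split.TypeLift.MixT3Q1

/-- `den > 0` for `n ≥ 13`. -/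
theorem den_pos (n : ℚ) (hn : 13 ≤ n) : 0 < den n := by
  obtain ⟨n', hn', rfl⟩ : ∃ n', 0 ≤ n' ∧ n = 13 + n' := ⟨n - 13, by linarith, by ring⟩
  have h : den (13 + n') = 31104 * n' ^ 15 + 5316192 * n' ^ 14 + 423576432 * n' ^ 13 + 20866731624 * n' ^ 12 + 710677243692 * n' ^ 11 + 17722212099048 * n' ^ 10 + 334231056477012 * n' ^ 9 + 4853567814277344 * n' ^ 8 + 54708444756981444 * n' ^ 7 + 478587871086045672 * n' ^ 6 + 3222253955543903004 * n' ^ 5 + 16395210198770917800 * n' ^ 4 + 61016653549743221808 * n' ^ 3 + 156780884491146262752 * n' ^ 2 + 248667705597756037248 * n' + 183508131057743849472 := by unfold den; ring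
  rw [h]; positivity

/-- `Yc > 0` for `n ≥ 5`. -/
theorem Yc_pos (n : ℚ) (hn : 5 ≤ n) : 0 < Yc n := by
  obtain ⟨n', hn', rfl⟩ : ∃ n', 0 ≤ n' ∧ n = 5 + n' := ⟨n - 5, by linarith, by ring⟩
  have h : Yc (5 + n') = (1 / 120) * n' ^ 5 + (1 / 8) * n' ^ 4 + (17 / 24) * n' ^ 3 + (15 / 8) * n' ^ 2 + (137 / 60) * n' + 1 := by unfold Yc; ring
  rw [h]; positivity

/-- `Pc > 0` for `n ≥ 13`. -/
theorem Pc_pos (n : ℚ) (hn : 13 ≤ n) : 0 < Pc n := by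
  obtain ⟨n', hn', rfl⟩ : ∃ n', 0 ≤ n' ∧ n = 13 + n' := ⟨n - 13, by linarith, by ring⟩
  have h : Pc (13 + n') = (1 / 24) * n' ^ 4 + (23 / 12) * n' ^ 3 + (791 / 24) * n' ^ 2 + (2977 / 12) * n' + 684 := by unfold Pc; ring
  rw [h]; positivity

end PercRepro.PuncturedLYM.Split.TypeLift.MixT3Q1
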